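import Summits.ValiantsHypothesis.ValiantsHypothesis.Theorems.BarrierLeverNaturalProofsAgainstAllLinearSizesOfCountCertificate

/-!
# Route BarrierLever — item `NaturalProofsAgainstAllLinearSizesOfCount` (stmt-ValiantsHypothesis-19261),
# part 2/3: size and degree of the certificate

Continuation of `…NaturalProofsAgainstAllLinearSizesOfCountCertificate.lean` (memo S2(iii)): the
entries of the Macaulay matrix over the coefficient ring are ℂ-LINEAR forms in the coefficient
variables (`macaulay_generic_mem_linSpan`); hence `deg certPoly ≤ R` (`totalDegree_certPoly_le`) and
`L(certPoly) ≤ 8(R+1)^7 + R²·2N` (`complexity_certPoly_le`, Berkowitz via the tree's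
`complexity_detPoly_le`), `R = #mons k (k(n-2)+1)`, `N = #degLEMonomials n`;
`certPoly_mem_distinguishers`; and `naturalProofsAgainstLinearSize_of_AG_and_arith`: the level-`c`
instance of item 20156 follows from `GenericGradientFibreCount (k n) n` and three numerical
inequalities in `n, k n, R, N` (discharged in part 3, `…NaturalProofsAgainstAllLinearSizesOfCount.lean`).

Lean text authored by the cell planner seat `valiant-natproofs-p2` (gen 4, HOME/NaturalBSAll-p2g4.lean,
referee REF-G11 PASS), ported by the prover seat.

WHAT THIS IS NOT: the AG count (item stmt-19256) is not proved here; nothing on FSV Question 6.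

References: Berkowitz 1984 via `DetInVP`; [CoxLittleOSheaUsing2005] Ch. 3 §4.
-/

-- layout Summits/ValiantsHypothesis/ValiantsHypothesis forces the duplicated namespace component
set_option linter.dupNamespace false

noncomputable section

open MvPolynomial Finset

namespace Summit.ValiantsHypothesis.ValiantsHypothesis.Theorems.BarrierLever.NaturalProofsAgainstAllLinearSizes

open Literature.Computability.AlgebraicComplexity
open Literature.Computability.AlgebraicComplexity.DegreeBound Literature.RingTheory.MvPolynomial.Macaulay
open Literature.Barriers.ValiantsHypothesis

/-! ## Memo S2(iii): size and degree of the certificate. The entries of the Macaulay matrix over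
the coefficient ring are ℂ-LINEAR forms in the coefficient variables; hence
`deg certPoly ≤ R` and `L(certPoly) ≤ 8(R+1)^7 + R²·2N` (Berkowitz via `complexity_detPoly_le`),
`R = #mons k (k(n-2)+1)`, `N = #degLEMonomials n`. What remains is pure arithmetic. -/

section linear

variable (n : ℕ)

/-- The ℂ-span of the coefficient variables inside the coefficient ring. -/
def linSpan : Submodule ℂ (MvPolynomial (degLEMonomials n) ℂ) :=
  Submodule.span ℂ (Set.range (X : degLEMonomials n → MvPolynomial (degLEMonomials n) ℂ))

variable {n}

/-- Coefficient variables are linear forms. -/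
theorem X_mem_linSpan (m : degLEMonomials n) : X m ∈ linSpan n :=
  Submodule.subset_span ⟨m, rfl⟩

/-- A linear form is a ℂ-combination of the coefficient variables. -/
theorem exists_eq_sum_of_mem_linSpan {p : MvPolynomial (degLEMonomials n) ℂ} (hp : p ∈ linSpan n) :
    ∃ c : degLEMonomials n → ℂ, p = ∑ m, c m • X m := by
  obtain ⟨c, hc⟩ := (Submodule.mem_span_range_iff_exists_fun ℂ).1 hp
  exact ⟨c, hc.symm⟩

/-- A linear form in `N` variables has complexity `≤ 2N`. -/
theorem complexity_le_of_mem_linSpan {p : MvPolynomial (degLEMonomials n) ℂ} (hp : p ∈ linSpan n) :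
    complexity p ≤ 2 * Fintype.card (degLEMonomials n) := by
  classical
  obtain ⟨c, rfl⟩ := exists_eq_sum_of_mem_linSpan hp
  refine (complexity_finset_sum_le _ _).trans ?_
  have h1 : ∀ m : degLEMonomials n,
      complexity (c m • X m : MvPolynomial (degLEMonomials n) ℂ) ≤ 1 := fun m =>
    (complexity_smul_le_holds _ _).trans (by rw [complexity_X_holds])
  calc ∑ m, complexity (c m • X m : MvPolynomial (degLEMonomials n) ℂ) + (univ : Finset _).card
      ≤ ∑ _m : degLEMonomials n, 1 + (univ : Finset (degLEMonomials n)).card :=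
        Nat.add_le_add_right (Finset.sum_le_sum fun m _ => h1 m) _
    _ = 2 * Fintype.card (degLEMonomials n) := by simp [two_mul]

/-- A linear form has degree `≤ 1`. -/
theorem totalDegree_le_of_mem_linSpan {p : MvPolynomial (degLEMonomials n) ℂ} (hp : p ∈ linSpan n) :
    p.totalDegree ≤ 1 := by
  classical
  obtain ⟨c, rfl⟩ := exists_eq_sum_of_mem_linSpan hp
  exact totalDegree_finsetSum_le fun m _ => (totalDegree_smul_le _ _).trans (by simp [totalDegree_X])

/-- A product of powers of restricted variables is a monic monomial or zero. -/
theorem prod_restr_pow_eq {R : Type} [CommSemiring R] (n k : ℕ) (d : Fin n →₀ ℕ) :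
    (∏ j, restr R n k j ^ d j) = 0 ∨ ∃ m : Fin k →₀ ℕ, (∏ j, restr R n k j ^ d j) = monomial m 1 := by
  classical
  refine Finset.prod_induction _ (fun x => x = 0 ∨ ∃ m : Fin k →₀ ℕ, x = monomial m 1) ?_ ?_ ?_
  · rintro a b (rfl | ⟨ma, rfl⟩) (rfl | ⟨mb, rfl⟩)
    · exact Or.inl (zero_mul _)
    · exact Or.inl (zero_mul _)
    · exact Or.inl (mul_zero _)
    · exact Or.inr ⟨ma + mb, by rw [monomial_mul, one_mul]⟩
  · exact Or.inr ⟨0, by rw [← C_1, C_apply]⟩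
  · intro j _
    rcases restr_spec (R := R) n k j with ⟨i, hi⟩ | h0
    · exact Or.inr ⟨Finsupp.single i (d j), by rw [hi, X_pow_eq_monomial]⟩
    · rw [h0]
      rcases Nat.eq_zero_or_pos (d j) with h | h
      · exact Or.inr ⟨0, by rw [h, pow_zero, ← C_1, C_apply]⟩
      · exact Or.inl (zero_pow (by omega))

variable (L : Submodule ℂ (MvPolynomial (degLEMonomials n) ℂ))

/-- Restricting a polynomial with coefficients in `L` keeps coefficients in `L`. -/
theorem coeff_aeval_restr_mem {N k : ℕ} (p : MvPolynomial (Fin N) (MvPolynomial (degLEMonomials n) ℂ))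
    (hp : ∀ d, coeff d p ∈ L) (γ : Fin k →₀ ℕ) :
    coeff γ (aeval (restr (MvPolynomial (degLEMonomials n) ℂ) N k) p) ∈ L := by
  classical
  rw [aeval_def, eval₂_eq', coeff_sum]
  refine Submodule.sum_mem _ fun d _ => ?_
  rw [show algebraMap (MvPolynomial (degLEMonomials n) ℂ)
      (MvPolynomial (Fin k) (MvPolynomial (degLEMonomials n) ℂ)) (coeff d p) = C (coeff d p) from rfl,
    coeff_C_mul]
  rcases prod_restr_pow_eq (R := MvPolynomial (degLEMonomials n) ℂ) N k d with h0 | ⟨m, hm⟩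
  · rw [h0, coeff_zero, mul_zero]; exact zero_mem _
  · rw [hm, coeff_monomial]
    split_ifs
    · rw [mul_one]; exact hp d
    · rw [mul_zero]; exact zero_mem _

/-- Homogeneous components keep coefficients in `L`. -/
theorem coeff_homogeneousComponent_mem {τ : Type} {q : MvPolynomial τ (MvPolynomial (degLEMonomials n) ℂ)}
    (hq : ∀ d, coeff d q ∈ L) (m : ℕ) (d : τ →₀ ℕ) : coeff d (homogeneousComponent m q) ∈ L := by
  rw [coeff_homogeneousComponent]
  split_ifs
  · exact hq d
  · exact zero_mem _

/-- Partial derivatives keep coefficients in `L`. -/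
theorem coeff_pderiv_mem {τ : Type} {q : MvPolynomial τ (MvPolynomial (degLEMonomials n) ℂ)}
    (hq : ∀ d, coeff d q ∈ L) (i : τ) (d : τ →₀ ℕ) : coeff d (pderiv i q) ∈ L := by
  classical
  rw [coeff_pderiv, ← Nat.cast_succ, mul_comm, ← nsmul_eq_mul]
  exact nsmul_mem (hq _) _

/-- Multiplying by a monic monomial keeps coefficients in `L`. -/
theorem coeff_monomial_mul_mem {τ : Type} {q : MvPolynomial τ (MvPolynomial (degLEMonomials n) ℂ)}
    (hq : ∀ d, coeff d q ∈ L) (a β : τ →₀ ℕ) : coeff β (monomial a 1 * q) ∈ L := by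
  classical
  rw [coeff_monomial_mul']
  split_ifs
  · rw [one_mul]; exact hq _
  · exact zero_mem _

/-- Every entry of the Macaulay matrix over the coefficient ring is a linear form in the
coefficient variables. -/
theorem macaulay_generic_mem_linSpan (n k : ℕ) (α β : mons k (critDeg k (n - 1))) :
    macaulayR (n - 1) (fun i => pderiv i (homogeneousComponent n
      (aeval (restr (MvPolynomial (degLEMonomials n) ℂ) n k) (generic n)))) α β ∈ linSpan n := by
  simp only [macaulayR, rowPolyR]
  refine coeff_monomial_mul_mem _ (fun d => ?_) _ _
  refine coeff_pderiv_mem _ (fun d => ?_) _ _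
  refine coeff_homogeneousComponent_mem _ (fun d => ?_) _ _
  refine coeff_aeval_restr_mem _ _ (fun d => ?_) _
  rw [coeff_generic]
  split_ifs
  · exact X_mem_linSpan _
  · exact zero_mem _

end linear

/-- Degree of a determinant with entries of degree `≤ 1`. -/
theorem totalDegree_det_le_card {ι τ : Type} [Fintype ι] [DecidableEq ι]
    (M : Matrix ι ι (MvPolynomial τ ℂ)) (hM : ∀ i j, (M i j).totalDegree ≤ 1) :
    M.det.totalDegree ≤ Fintype.card ι := by
  rw [Matrix.det_apply]
  refine totalDegree_finsetSum_le fun σ' _ => ?_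
  have hprod : (∏ i, M (σ' i) i).totalDegree ≤ Fintype.card ι :=
    (totalDegree_finsetProd _ _).trans (by
      calc ∑ i, (M (σ' i) i).totalDegree ≤ ∑ _i : ι, 1 := Finset.sum_le_sum fun i _ => hM _ _
        _ = Fintype.card ι := by simp)
  rcases Int.units_eq_one_or (Equiv.Perm.sign σ') with h | h
  · rw [h, one_smul]; exact hprod
  · rw [h, Units.neg_smul, one_smul, totalDegree_neg]; exact hprod

/-- Complexity of a determinant from the complexity of its entries (Berkowitz, via the tree's
`complexity_detPoly_le`, after reindexing to `Fin r`). -/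
theorem complexity_det_le {ι τ : Type} [Fintype ι] [DecidableEq ι]
    (M : Matrix ι ι (MvPolynomial τ ℂ)) (B : ℕ) (hM : ∀ i j, complexity (M i j) ≤ B) :
    complexity M.det ≤ 8 * (Fintype.card ι + 1) ^ 7 + Fintype.card ι ^ 2 * B := by
  classical
  set r := Fintype.card ι
  let e : ι ≃ Fin r := Fintype.equivFin ι
  have hdet : M.det =
      aeval (fun p : Fin r × Fin r => M (e.symm p.1) (e.symm p.2)) (detPoly (Fin r) ℂ) := by
    rw [detPoly, AlgHom.map_det, AlgHom.mapMatrix_apply, ← Matrix.det_reindex_self e M]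
    congr 1
    ext i j
    simp [Matrix.mvPolynomialX, Matrix.reindex_apply]
  rw [hdet]
  refine (complexity_aeval_le _ _).trans (Nat.add_le_add (complexity_detPoly_le ℂ r) ?_)
  calc ∑ p : Fin r × Fin r, complexity (M (e.symm p.1) (e.symm p.2))
      ≤ ∑ _p : Fin r × Fin r, B := Finset.sum_le_sum fun p _ => hM _ _
    _ = r ^ 2 * B := by simp [sq]

/-- **Memo S2(iii), degree**: `deg certPoly ≤ R = #mons k (k(n-2)+1)`. -/
theorem totalDegree_certPoly_le (n k : ℕ) :
    (certPoly n k).totalDegree ≤ (mons k (critDeg k (n - 1))).card := by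
  classical
  rw [← Fintype.card_coe]
  exact totalDegree_det_le_card _ fun α β =>
    totalDegree_le_of_mem_linSpan (macaulay_generic_mem_linSpan n k α β)

/-- **Memo S2(iii), size**: `L(certPoly) ≤ 8(R+1)^7 + R²·2N`. -/
theorem complexity_certPoly_le (n k : ℕ) :
    complexity (certPoly n k) ≤ 8 * ((mons k (critDeg k (n - 1))).card + 1) ^ 7 +
      (mons k (critDeg k (n - 1))).card ^ 2 * (2 * Fintype.card (degLEMonomials n)) := by
  classical
  rw [← Fintype.card_coe]
  exact complexity_det_le _ _ fun α β =>
    complexity_le_of_mem_linSpan (macaulay_generic_mem_linSpan n k α β)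

/-- The certificate is a legitimate distinguisher as soon as two numerical inequalities hold. -/
theorem certPoly_mem_distinguishers {n k a : ℕ}
    (h1 : 8 * ((mons k (critDeg k (n - 1))).card + 1) ^ 7 +
      (mons k (critDeg k (n - 1))).card ^ 2 * (2 * Fintype.card (degLEMonomials n)) ≤
        (Nat.choose (2 * n) n) ^ a)
    (h2 : (mons k (critDeg k (n - 1))).card ≤ (Nat.choose (2 * n) n) ^ a) :
    certPoly n k ∈ Distinguishers ℂ n a :=
  ⟨(complexity_certPoly_le n k).trans h1, (totalDegree_certPoly_le n k).trans h2⟩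

/-- **The item modulo the AG count and ARITHMETIC only.** With `R n = #mons (k n) (k n·(n-2)+1)`
(`= binom(k n·(n-1), k n - 1)`) and `N n = #degLEMonomials n` (`= binom(2n, n)`), the level-`c`
instance of `BarrierLever.NaturalProofsAgainstAllLinearSizes` follows from
(1) `GenericGradientFibreCount (k n) n` (CLO UAG 3.(5.5) + generic smoothness) and
(2) three numerical inequalities, for all `n ≥ n₀`. -/
theorem naturalProofsAgainstLinearSize_of_AG_and_arith (c a n₀ : ℕ) (k : ℕ → ℕ)
    (hAG : ∀ n, n₀ ≤ n → GenericGradientFibreCount (k n) n)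
    (harith : ∀ n, n₀ ≤ n → 1 ≤ n ∧ k n ≤ n ∧ 2 ^ (k n + 3 * (c * n)) < (n - 1) ^ (k n))
    (hsize : ∀ n, n₀ ≤ n →
      8 * ((mons (k n) (critDeg (k n) (n - 1))).card + 1) ^ 7 +
        (mons (k n) (critDeg (k n) (n - 1))).card ^ 2 * (2 * Fintype.card (degLEMonomials n)) ≤
          (Nat.choose (2 * n) n) ^ a ∧
      (mons (k n) (critDeg (k n) (n - 1))).card ≤ (Nat.choose (2 * n) n) ^ a) :
    ∀ n ≥ n₀, ¬ IsSuccinctHittingSet (degLEMonomials n)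
      {f : MvPolynomial (Fin n) ℂ | f.totalDegree ≤ n ∧ complexity f ≤ c * n}
      (Distinguishers ℂ n a) :=
  naturalProofsAgainstLinearSize_of_inputs c a n₀ k hAG harith fun n hn =>
    certPoly_mem_distinguishers (hsize n hn).1 (hsize n hn).2

end Summit.ValiantsHypothesis.ValiantsHypothesis.Theorems.BarrierLever.NaturalProofsAgainstAllLinearSizes

end
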